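import Summits.Ventures.HSemireg.WedgeHankelRecurrenceModule
import Summits.Ventures.HSemireg.WedgeHankelSpikes

/-!
# Venture HSemireg — THE MODULI OF MINIMAL RECURRENCES: for `2r ≤ N + 1`, **every non-zero polynomial `p₀` of degree `≤ r` is the minimal recurrence of a class `q` with middle rank
# `R(q) = r`** (`Rec_r(q) = K · p₀`), so the minimal-recurrence lines of the rank-`r` classes are EXACTLY the lines of `K[X]_{≤ r}` — the projective space of binary `r`-forms =
# effective divisors of degree `r` on `P¹`, split or not; the witness is the CHARACTERISTIC SEQUENCE `charSeq m` (`q_j = [X^{d−1}](X^j mod m)`) of the monic part `m`, plus a spike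
# `δ_{N+1−e}` carrying the node at infinity to order `e − 1` (`r = d + e`)

HONEST FRAMING. Part of the Lean index of the computation cell `pub-hsemireg` (seat p10 gen 26, Sunday typer «UNIFORM-IN-n»).
LINEAR ALGEBRA OF HANKEL (catalecticant) MATRICES and of polynomials over a field ONLY (`Polynomial.modByMonic`): no variety, no cohomology theory, no sheaf, no Ext group and no
semiregularity map is constructed here; nothing here says that HC / HC_CM / HC_AV holds; no Literature fact is declared or used.  Custodian versions as in `WedgeHankelSiegelIdeal` (1/3); the
dictionary (`charSeq m` = the impulse response of the recurrence `m` = the moments of the functional `a ↦ [x^{d−1}] a` on `K[X]/(m)`; `δ_c` = the class `Θ^c/c!`; a line `K · p₀ ⊆ K[X]_{≤r}` =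
an effective divisor of degree `r` on `P¹`, `∞` with multiplicity `r − deg p₀`) is QUOTED, never asserted.

WHAT IS IN THE TREE / KEYED.  N18 (`WedgeHankelRecurrenceModule`, № 173): `hkFun`, `recSpace`, `mem_recSpace_iff`, `hkFun_monomial`, `hkFun_add_seq`, `recSpace_inf_le_recSpace_add`,
`finrank_recSpace_add_rank`, `finrank_recSpace_self`, `exists_recSpace_self_eq_span`, `natDegree_le_of_mem_recSpace`, `finiteDimensional_recSpace`; N15 `rank_hankel1_eq_min` (the trapezoid
law); `WedgeHankelSpikes.spikeSeq`.  Mathlib: `Polynomial.modByMonic` (`add_modByMonic`, `smul_modByMonic`, `mul_modByMonic`, `modByMonic_eq_zero_iff_dvd`, `modByMonic_eq_self_iff`,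
`natDegree_modByMonic_lt`, `modByMonic_one`), `coeff_X_pow_mul'`, `monic_mul_leadingCoeff_inv`, `Submodule.span_singleton_smul_eq`.
THIS FILE (namespace `Summit.Ventures.HSemireg.Wedge.HankelOuter` continued; CHAINED on N18; 1 definition `charSeq`):
* §491 `charSeq m j := [X^{d−1}] (X^j mod m)`; **`hkFun_charSeq`** (`⟪p, charSeq m⟫_s = [X^{d−1}]((X^s p) mod m)`), `mem_recSpace_charSeq_of_dvd` (multiples of `m` are recurrences, every
  window), **`eq_zero_of_forall_coeff_X_pow_mul_modByMonic`** (the functional is NON-DEGENERATE on residues: back-substitution along the anti-diagonal), **`mem_recSpace_charSeq_iff`**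
  (`k + d ≤ N + 1`: `p ∈ Rec_k(charSeq m) ↔ deg p ≤ k ∧ m ∣ p`).
* §492 `recSpace_charSeq_eq_bot` (`k < d`), **`recSpace_charSeq_self_eq_span`** (`2d ≤ N + 1`: `Rec_d(charSeq m) = K · m`), `rank_hankel1_charSeq_of_lt` (`= k + 1`), `rank_hankel1_charSeq_self`
  (`= d`), **`rank_hankel1_half_charSeq`** (`R(charSeq m) = d`).
* §493 `hkFun_spikeSeq_of_le` / `_of_lt` (`⟪p, δ_c⟫_s = p_{c−s}`), and for `1 ≤ e`, `2(d + e) ≤ N + 1`: `mem_recSpace_charSeq_add_spike` (`m ∈ Rec_{d+e}(charSeq m + δ_{N+1−e})`),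
  **`recSpace_charSeq_add_spike_eq_bot`** (no recurrence of window `d + e`: far from the top the spike is invisible so `m ∣ p`, then the spike equations kill the coefficients of `p` in
  `[d, N + 1 − e]`), **`rank_hankel1_half_charSeq_add_spike`** (`R = d + e`), **`recSpace_charSeq_add_spike_self_eq_span`** (`Rec_{d+e} = K · m`).
* §494 **`exists_rank_half_eq_and_recSpace_eq_span_of_monic`** (every monic `m`, every order `e` at infinity), **`exists_rank_half_eq_and_recSpace_eq_span`** (THE PERIOD MAP IS ONTO:
  every `p₀ ≠ 0`, `deg p₀ ≤ r`, `2r ≤ N + 1`, is the minimal recurrence of some `q` with `R(q) = r`), **`setOf_recSpace_self_eq`** (THE MODULI: `{Rec_r(q) : R(q) = r} = {K · p₀ : p₀ ≠ 0,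
  deg p₀ ≤ r}`).
READING: N18 attached to every class of middle rank `r ≤ (N+1)/2` one line `K · m ⊆ K[X]_{≤ r}`; N19/N20 computed it for the secant / divisor classes (split divisors); this file shows
EVERY line occurs — over any field the minimal recurrences of the rank-`r` classes are parametrised by `P(K[X]_{≤r}) ≅ P^r = Sym^r(P¹)`, irreducible `m` included; with N21/N5 the
same `P^r` parametrises the degree-`k` kernels `Kr(univ, w_N(q), k)` of these classes throughout the window `r ≤ k ≤ N + 1 − r`.  Nothing Ext-side.  New names only.
-/

open Module Polynomial
open scoped Matrix Polynomial

namespace Summit.Ventures.HSemireg.Wedge.HankelOuter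

open Summit.Ventures.HSemireg.Wedge Summit.Ventures.HSemireg.Wedge.Hankel Summit.Ventures.HSemireg.Wedge.HankelSpikes

variable (K : Type*) [Field K] {N : ℕ}

/-! ## §491. The characteristic sequence of a monic polynomial: `q_j = [X^{d−1}] (X^j mod m)` -/

/-- THE CHARACTERISTIC SEQUENCE of a monic `m` of degree `d`: `charSeq m j := [X^{d−1}] (X^j mod m)` — the impulse response of the recurrence `m` (quoted: the functional
`a ↦ [x^{d−1}] a` on `K[X]/(m)` applied to the powers of `x`). -/
noncomputable def charSeq (m : K[X]) : ℕ → K := fun j => (Polynomial.X ^ j %ₘ m).coeff (m.natDegree - 1)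

/-- **`⟪p, charSeq m⟫_s = [X^{d−1}] ((X^s · p) mod m)`.** -/
theorem hkFun_charSeq (m : K[X]) (s : ℕ) (p : K[X]) :
    hkFun K (charSeq K m) s p = (Polynomial.X ^ s * p %ₘ m).coeff (m.natDegree - 1) := by
  induction p using Polynomial.induction_on' with
  | add p p' hp hp' => rw [map_add, hp, hp', mul_add, Polynomial.add_modByMonic, Polynomial.coeff_add]
  | monomial i c =>
    rw [hkFun_monomial, charSeq, Polynomial.X_pow_mul_monomial, ← Polynomial.C_mul_X_pow_eq_monomial, Polynomial.C_mul', Polynomial.smul_modByMonic,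
      Polynomial.coeff_smul, smul_eq_mul]

/-- a multiple of `m` is a recurrence of `charSeq m` in every window holding it (`deg p ≤ k`; every `N`). -/
theorem mem_recSpace_charSeq_of_dvd {m : K[X]} (hm : m.Monic) {k : ℕ} {p : K[X]} (hp : p ∈ Polynomial.degreeLT K (k + 1)) (hdvd : m ∣ p) :
    p ∈ recSpace K N (charSeq K m) k := by
  rw [mem_recSpace_iff]
  refine ⟨hp, fun s _ => ?_⟩
  rw [hkFun_charSeq, (Polynomial.modByMonic_eq_zero_iff_dvd hm).mpr (dvd_mul_of_dvd_right hdvd _), Polynomial.coeff_zero]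

/-- the functional is NON-DEGENERATE on residues: if `deg a < d` and `[X^{d−1}](X^s · a mod m) = 0` for all `s < d`, then `a = 0` (back-substitution along the anti-diagonal of the
impulse-response Hankel matrix). -/
theorem eq_zero_of_forall_coeff_X_pow_mul_modByMonic {m : K[X]} (hm : m.Monic) {a : K[X]} (ha : a.natDegree < m.natDegree)
    (h : ∀ s < m.natDegree, (Polynomial.X ^ s * a %ₘ m).coeff (m.natDegree - 1) = 0) : a = 0 := by
  -- `key n`: all coefficients of index `≥ d − n` vanish
  have key : ∀ n ≤ m.natDegree, ∀ j, m.natDegree - n ≤ j → a.coeff j = 0 := by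
    intro n
    induction n with
    | zero =>
      intro _ j hj
      exact Polynomial.coeff_eq_zero_of_natDegree_lt (by omega)
    | succ n ih =>
      intro hn j hj
      rcases Nat.lt_or_ge (m.natDegree - (n + 1)) j with hlt | hle
      · exact ih (by omega) j (by omega)
      · -- `j = d − (n+1)`: the coefficients above `j` vanish, so `X^n · a` has degree `< d` and is its own residue
        have hna : a.natDegree ≤ j := (Polynomial.natDegree_le_iff_coeff_eq_zero).mpr fun i hi => ih (by omega) i (by omega)
        have hlt : (Polynomial.X ^ n * a).natDegree < m.natDegree := by
          have hmul := Polynomial.natDegree_mul_le (p := Polynomial.X ^ n) (q := a)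
          rw [Polynomial.natDegree_X_pow] at hmul
          omega
        have hself : Polynomial.X ^ n * a %ₘ m = Polynomial.X ^ n * a := (Polynomial.modByMonic_eq_self_iff hm).mpr (Polynomial.degree_lt_degree hlt)
        have h1 := h n (by omega)
        rw [hself, Polynomial.coeff_X_pow_mul', if_pos (by omega), show m.natDegree - 1 - n = j by omega] at h1
        exact h1
  ext j
  rw [Polynomial.coeff_zero]
  exact key m.natDegree le_rfl j (by omega)

/-- **THE RECURRENCES OF THE CHARACTERISTIC SEQUENCE ARE THE MULTIPLES OF `m` INSIDE THE WINDOW: for `k + d ≤ N + 1`, `p ∈ Rec_k(charSeq m) ↔ deg p ≤ k ∧ m ∣ p`.** -/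
theorem mem_recSpace_charSeq_iff {m : K[X]} (hm : m.Monic) {k : ℕ} (hk : k + m.natDegree ≤ N + 1) (p : K[X]) :
    p ∈ recSpace K N (charSeq K m) k ↔ p ∈ Polynomial.degreeLT K (k + 1) ∧ m ∣ p := by
  refine ⟨fun hp => ⟨recSpace_le_degreeLT K _ k hp, ?_⟩, fun h => mem_recSpace_charSeq_of_dvd K hm h.1 h.2⟩
  rw [← Polynomial.modByMonic_eq_zero_iff_dvd hm]
  by_cases hm1 : m = 1
  · rw [hm1, Polynomial.modByMonic_one]
  refine eq_zero_of_forall_coeff_X_pow_mul_modByMonic K hm (Polynomial.natDegree_modByMonic_lt p hm hm1) fun s hs => ?_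
  -- `X^s · (p mod m) ≡ X^s · p (mod m)` and the latter's top residue coefficient is `⟪p, charSeq m⟫_s = 0`
  have e : Polynomial.X ^ s * (p %ₘ m) %ₘ m = Polynomial.X ^ s * p %ₘ m := by
    rw [Polynomial.mul_modByMonic, (Polynomial.modByMonic_eq_self_iff hm).mpr (Polynomial.degree_modByMonic_lt p hm), ← Polynomial.mul_modByMonic]
  rw [e, ← hkFun_charSeq]
  exact ((mem_recSpace_iff K).mp hp).2 s (by omega)

/-! ## §492. The characteristic sequence has middle rank `d` and minimal recurrence `m` (`2d ≤ N + 1`) -/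

/-- no recurrence below the degree: `Rec_k(charSeq m) = 0` for `k < d`, `k + d ≤ N + 1`. -/
theorem recSpace_charSeq_eq_bot {m : K[X]} (hm : m.Monic) {k : ℕ} (hkd : k < m.natDegree) (hk : k + m.natDegree ≤ N + 1) :
    recSpace K N (charSeq K m) k = ⊥ := by
  rw [Submodule.eq_bot_iff]
  intro p hp
  obtain ⟨hdeg, hdvd⟩ := (mem_recSpace_charSeq_iff K hm hk p).mp hp
  by_contra hne
  have h1 := Polynomial.natDegree_le_of_dvd hdvd hne
  have h2 := (mem_degreeLT_succ_iff K).mp hdeg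
  omega

/-- **`Rec_d(charSeq m) = K · m`** for `2d ≤ N + 1`: the minimal recurrence of the characteristic sequence is `m`. -/
theorem recSpace_charSeq_self_eq_span {m : K[X]} (hm : m.Monic) (h2d : m.natDegree + m.natDegree ≤ N + 1) :
    recSpace K N (charSeq K m) m.natDegree = K ∙ m := by
  refine le_antisymm (fun p hp => ?_) ((Submodule.span_singleton_le_iff_mem _ _).mpr
    (mem_recSpace_charSeq_of_dvd K hm ((mem_degreeLT_succ_iff K).mpr le_rfl) (dvd_refl m)))
  obtain ⟨hdeg, g, rfl⟩ := (mem_recSpace_charSeq_iff K hm h2d p).mp hp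
  rw [Submodule.mem_span_singleton]
  by_cases hg : g = 0
  · exact ⟨0, by rw [hg, mul_zero, zero_smul]⟩
  · have h1 := (mem_degreeLT_succ_iff K).mp hdeg
    rw [Polynomial.natDegree_mul hm.ne_zero hg] at h1
    obtain ⟨c, hc⟩ : ∃ c : K, g = Polynomial.C c := ⟨g.coeff 0, Polynomial.eq_C_of_natDegree_eq_zero (by omega)⟩
    exact ⟨c, by rw [hc, mul_comm, Polynomial.C_mul']⟩

/-- `rank H_k(charSeq m) = k + 1` below the degree (`k < d`, `k + d ≤ N + 1`). -/
theorem rank_hankel1_charSeq_of_lt {m : K[X]} (hm : m.Monic) {k : ℕ} (hkd : k < m.natDegree) (hk : k + m.natDegree ≤ N + 1) :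
    (hankel1 K N k (charSeq K m)).rank = k + 1 := by
  have h := finrank_recSpace_add_rank K (N := N) k (charSeq K m)
  rw [recSpace_charSeq_eq_bot K hm hkd hk, finrank_bot] at h
  omega

/-- `rank H_d(charSeq m) = d` (`2d ≤ N + 1`). -/
theorem rank_hankel1_charSeq_self {m : K[X]} (hm : m.Monic) (h2d : m.natDegree + m.natDegree ≤ N + 1) :
    (hankel1 K N m.natDegree (charSeq K m)).rank = m.natDegree := by
  have h := finrank_recSpace_add_rank K (N := N) m.natDegree (charSeq K m)
  rw [recSpace_charSeq_self_eq_span K hm h2d, finrank_span_singleton hm.ne_zero] at h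
  omega

/-- **`R(charSeq m) = d`**: the middle rank of the characteristic sequence of a monic `m` of degree `d` is `d` (`2d ≤ N + 1`). -/
theorem rank_hankel1_half_charSeq {m : K[X]} (hm : m.Monic) (h2d : m.natDegree + m.natDegree ≤ N + 1) :
    (hankel1 K N (N / 2) (charSeq K m)).rank = m.natDegree := by
  rcases Nat.eq_zero_or_pos m.natDegree with hd | hd
  · -- `m = 1`: the characteristic sequence vanishes
    have hm1 : m = 1 := Polynomial.eq_one_of_monic_natDegree_zero hm hd
    have hq : charSeq K m = 0 := by
      funext j; rw [charSeq, hm1, Polynomial.modByMonic_one, Polynomial.coeff_zero, Pi.zero_apply]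
    have hz : hankel1 K N (N / 2) (0 : ℕ → K) = 0 := by ext i s; rfl
    rw [hd, hq, hz, Matrix.rank_zero]
  · have hRle : (hankel1 K N (N / 2) (charSeq K m)).rank ≤ N / 2 + 1 := Matrix.rank_le_height _
    have hA := rank_hankel1_eq_min K (show m.natDegree - 1 ≤ N by omega) (charSeq K m)
    rw [rank_hankel1_charSeq_of_lt K hm (by omega) (by omega)] at hA
    have hB := rank_hankel1_eq_min K (show m.natDegree ≤ N by omega) (charSeq K m)
    rw [rank_hankel1_charSeq_self K hm h2d] at hB
    omega

/-! ## §493. Adding the node at infinity: `q = charSeq m + δ_{N+1−e}` has middle rank `d + e` and minimal recurrence `m` -/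

/-- `⟪p, δ_c⟫_s = p_{c−s}` for `s ≤ c`. -/
theorem hkFun_spikeSeq_of_le {c s : ℕ} (hsc : s ≤ c) (p : K[X]) : hkFun K (spikeSeq K c) s p = p.coeff (c - s) := by
  induction p using Polynomial.induction_on' with
  | add p p' hp hp' => rw [map_add, hp, hp', Polynomial.coeff_add]
  | monomial i a =>
    rw [hkFun_monomial, spikeSeq_apply, Polynomial.coeff_monomial]
    by_cases h : i + s = c
    · rw [if_pos h, if_pos (by omega), mul_one]
    · rw [if_neg h, if_neg (by omega), mul_zero]

/-- `⟪p, δ_c⟫_s = 0` for `c < s`. -/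
theorem hkFun_spikeSeq_of_lt {c s : ℕ} (hcs : c < s) (p : K[X]) : hkFun K (spikeSeq K c) s p = 0 := by
  induction p using Polynomial.induction_on' with
  | add p p' hp hp' => rw [map_add, hp, hp', add_zero]
  | monomial i a => rw [hkFun_monomial, spikeSeq_apply, if_neg (by omega), mul_zero]

section Infinity

variable {m : K[X]} (hm : m.Monic) {e : ℕ} (he : 1 ≤ e) (h2r : (m.natDegree + e) + (m.natDegree + e) ≤ N + 1)
include hm he h2r

omit he h2r in
/-- `m` is a recurrence of window `d + e + 1` of `charSeq m + δ_{N+1−e}` (the spike sits beyond the reach of `m`'s coefficients). -/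
theorem mem_recSpace_charSeq_add_spike : m ∈ recSpace K N (charSeq K m + spikeSeq K (N + 1 - e)) (m.natDegree + e) := by
  refine recSpace_inf_le_recSpace_add K _ _ _ (Submodule.mem_inf.mpr ⟨?_, ?_⟩)
  · exact mem_recSpace_charSeq_of_dvd K hm ((mem_degreeLT_succ_iff K).mpr (by omega)) (dvd_refl m)
  · rw [mem_recSpace_iff]
    refine ⟨(mem_degreeLT_succ_iff K).mpr (by omega), fun s hs => ?_⟩
    rw [hkFun_spikeSeq_of_le K (by omega)]
    exact Polynomial.coeff_eq_zero_of_natDegree_lt (by omega)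

/-- below window `d + e` there is no recurrence of `charSeq m + δ_{N+1−e}`. -/
theorem recSpace_charSeq_add_spike_eq_bot : recSpace K N (charSeq K m + spikeSeq K (N + 1 - e)) (m.natDegree + e - 1) = ⊥ := by
  rw [Submodule.eq_bot_iff]
  intro p hp
  have hdeg := natDegree_le_of_mem_recSpace K hp
  have hrec := ((mem_recSpace_iff K).mp hp).2
  -- (1) far from the top the spike is invisible: `p` satisfies `m`'s recurrence in window `d + 2e − 1 + 1`, hence `m ∣ p`
  have h1 : p ∈ recSpace K N (charSeq K m) (m.natDegree + e - 1 + e) := by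
    rw [mem_recSpace_iff]
    refine ⟨(mem_degreeLT_succ_iff K).mpr (by omega), fun s hs => ?_⟩
    have := hrec s (by omega)
    rwa [hkFun_add_seq, hkFun_spikeSeq_of_le K (by omega), Polynomial.coeff_eq_zero_of_natDegree_lt (by omega), add_zero] at this
  obtain ⟨-, hdvd⟩ := (mem_recSpace_charSeq_iff K hm (by omega) p).mp h1
  -- (2) so `charSeq m` is killed in EVERY window, and the spike equations say `p_j = 0` for `d ≤ j ≤ N + 1 − e`
  have hzero : ∀ s, hkFun K (charSeq K m) s p = 0 := fun s => by
    rw [hkFun_charSeq, (Polynomial.modByMonic_eq_zero_iff_dvd hm).mpr (dvd_mul_of_dvd_right hdvd _), Polynomial.coeff_zero]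
  have hcoeff : ∀ j, m.natDegree ≤ j → p.coeff j = 0 := by
    intro j hj
    rcases Nat.lt_or_ge (m.natDegree + e - 1) j with hlt | hle
    · exact Polynomial.coeff_eq_zero_of_natDegree_lt (by omega)
    · have := hrec (N + 1 - e - j) (by omega)
      rwa [hkFun_add_seq, hzero, zero_add, hkFun_spikeSeq_of_le K (by omega), show N + 1 - e - (N + 1 - e - j) = j by omega] at this
  -- (3) a non-zero multiple of the monic `m` has a non-zero coefficient in degree `≥ d`
  by_contra hne
  have hnd : m.natDegree ≤ p.natDegree := Polynomial.natDegree_le_of_dvd hdvd hne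
  have hlead : p.coeff p.natDegree ≠ 0 := fun h0 => hne (Polynomial.leadingCoeff_eq_zero.mp h0)
  exact hlead (hcoeff _ hnd)

/-- **the middle rank of `charSeq m + δ_{N+1−e}` is `d + e`.** -/
theorem rank_hankel1_half_charSeq_add_spike : (hankel1 K N (N / 2) (charSeq K m + spikeSeq K (N + 1 - e))).rank = m.natDegree + e := by
  set q := charSeq K m + spikeSeq K (N + 1 - e)
  have hRle : (hankel1 K N (N / 2) q).rank ≤ N / 2 + 1 := Matrix.rank_le_height _
  -- rank `d + e` in degree `d + e − 1` (no recurrence), rank `≤ d + e` in degree `d + e` (`m` is one)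
  have hA0 := finrank_recSpace_add_rank K (N := N) (m.natDegree + e - 1) q
  rw [recSpace_charSeq_add_spike_eq_bot K hm he h2r, finrank_bot] at hA0
  have hA := rank_hankel1_eq_min K (show m.natDegree + e - 1 ≤ N by omega) q
  have hB0 := finrank_recSpace_add_rank K (N := N) (m.natDegree + e) q
  have hB1 : 1 ≤ finrank K (recSpace K N q (m.natDegree + e)) := by
    haveI := finiteDimensional_recSpace K (N := N) q (m.natDegree + e)
    have h := Submodule.finrank_mono ((Submodule.span_singleton_le_iff_mem m _).mpr (mem_recSpace_charSeq_add_spike K hm (N := N) (e := e)))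
    rw [finrank_span_singleton hm.ne_zero] at h
    exact h
  have hB := rank_hankel1_eq_min K (show m.natDegree + e ≤ N by omega) q
  omega

/-- **… and its minimal recurrence is `m`: `Rec_{d+e}(charSeq m + δ_{N+1−e}) = K · m`.** -/
theorem recSpace_charSeq_add_spike_self_eq_span : recSpace K N (charSeq K m + spikeSeq K (N + 1 - e)) (m.natDegree + e) = K ∙ m := by
  haveI := finiteDimensional_recSpace K (N := N) (charSeq K m + spikeSeq K (N + 1 - e)) (m.natDegree + e)
  symm
  refine Submodule.eq_of_le_of_finrank_eq ((Submodule.span_singleton_le_iff_mem _ _).mpr (mem_recSpace_charSeq_add_spike K hm (N := N) (e := e))) ?_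
  rw [finrank_span_singleton hm.ne_zero, finrank_recSpace_self K (rank_hankel1_half_charSeq_add_spike K hm he h2r) h2r]

end Infinity

/-! ## §494. THE MODULI: every line in `K[X]_{≤ r}` is the minimal recurrence of a class with middle rank `r` (`2r ≤ N + 1`) -/

/-- **every monic `m` of degree `d` with every order `e` at infinity, `2(d + e) ≤ N + 1`, is realised: some `q` has `R(q) = d + e` and `Rec_{d+e}(q) = K · m`.** -/
theorem exists_rank_half_eq_and_recSpace_eq_span_of_monic {m : K[X]} (hm : m.Monic) (e : ℕ) (h2r : (m.natDegree + e) + (m.natDegree + e) ≤ N + 1) :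
    ∃ q : ℕ → K, (hankel1 K N (N / 2) q).rank = m.natDegree + e ∧ recSpace K N q (m.natDegree + e) = K ∙ m := by
  rcases Nat.eq_zero_or_pos e with rfl | he
  · exact ⟨charSeq K m, by rw [add_zero]; exact rank_hankel1_half_charSeq K hm h2r, by rw [add_zero]; exact recSpace_charSeq_self_eq_span K hm h2r⟩
  · exact ⟨_, rank_hankel1_half_charSeq_add_spike K hm he h2r, recSpace_charSeq_add_spike_self_eq_span K hm he h2r⟩

/-- **THE PERIOD MAP IS ONTO: every non-zero `p₀` of degree `≤ r`, `2r ≤ N + 1`, is THE minimal recurrence of some class `q` with `R(q) = r`** (`Rec_r(q) = K · p₀`). -/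
theorem exists_rank_half_eq_and_recSpace_eq_span {r : ℕ} (h2r : r + r ≤ N + 1) {p₀ : K[X]} (hp₀ : p₀ ≠ 0) (hdeg : p₀.natDegree ≤ r) :
    ∃ q : ℕ → K, (hankel1 K N (N / 2) q).rank = r ∧ recSpace K N q r = K ∙ p₀ := by
  set m := p₀ * Polynomial.C (p₀.leadingCoeff)⁻¹ with hmdef
  have hm : m.Monic := Polynomial.monic_mul_leadingCoeff_inv hp₀
  have hmd : m.natDegree = p₀.natDegree := Polynomial.natDegree_mul_leadingCoeff_inv p₀ hp₀
  obtain ⟨e, he⟩ := Nat.exists_eq_add_of_le hdeg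
  have h2 : (m.natDegree + e) + (m.natDegree + e) ≤ N + 1 := by rw [hmd]; omega
  obtain ⟨q, hR, hRec⟩ := exists_rank_half_eq_and_recSpace_eq_span_of_monic K hm e h2
  refine ⟨q, by rw [hR, hmd, he], ?_⟩
  rw [show r = m.natDegree + e by rw [hmd, he], hRec, hmdef, mul_comm, Polynomial.C_mul']
  exact Submodule.span_singleton_smul_eq (IsUnit.mk0 _ (inv_ne_zero (Polynomial.leadingCoeff_ne_zero.mpr hp₀))) p₀

/-- **THE MODULI OF MINIMAL RECURRENCES: for `2r ≤ N + 1`, the minimal-recurrence lines of the classes with middle rank `r` are EXACTLY the lines `K · p₀`, `p₀ ≠ 0`, `deg p₀ ≤ r`** — the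
projective space of binary `r`-forms / effective divisors of degree `r` on `P¹` (non-split ones included). -/
theorem setOf_recSpace_self_eq {r : ℕ} (h2r : r + r ≤ N + 1) :
    {L : Submodule K K[X] | ∃ q : ℕ → K, (hankel1 K N (N / 2) q).rank = r ∧ recSpace K N q r = L}
      = {L | ∃ p₀ : K[X], p₀ ≠ 0 ∧ p₀.natDegree ≤ r ∧ L = K ∙ p₀} := by
  ext L
  constructor
  · rintro ⟨q, hR, rfl⟩
    obtain ⟨m, hm0, hm⟩ := exists_recSpace_self_eq_span K hR h2r
    refine ⟨m, hm0, ?_, hm⟩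
    exact natDegree_le_of_mem_recSpace K (N := N) (q := q) (by rw [hm]; exact Submodule.mem_span_singleton_self m)
  · rintro ⟨p₀, hp₀, hdeg, rfl⟩
    obtain ⟨q, hR, hRec⟩ := exists_rank_half_eq_and_recSpace_eq_span K h2r hp₀ hdeg
    exact ⟨q, hR, hRec⟩

end Summit.Ventures.HSemireg.Wedge.HankelOuter
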